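import Literature.Geometry.DiscreteGeometry.LayerStackings
import Summits.AtomisticToContinuum.Crystallization.Theorems.SquareWellLayerCakeStackingFaultSparsityLocalFramesOneLengthA

/-!
# Crux `StackingFaultSparsity` (stmt-AtomisticToContinuum-14296), line `Sketch` — stub
# `stub_barlowOfOneLength` (S12): one-length exact local frames ⇒ an isometric Barlow stacking

A nonempty point set `X ⊂ ℝ³` all of whose points carry exact ONE-LENGTH local frames
(in-layer length = inter-layer length = `d ∈ [19/20, 1]`; each point with its own unit normal) is
an isometric image of the close-packed Barlow stacking `barlowStacking d √(d² − d²/3) s` of a Hägg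
sequence `s`.

Proof. Scale by `2/d`: `V = {v | (d/2) v ∈ X}`.  Two distinct points of `X` at distance `≤ 1` are
at distance exactly `d` (closed-shell exactness), so `V` is a packing of unit balls.  The kissing
shell of `(2/d) p` in `V` is the scaled closed unit shell of `p`, a twelve-point configuration
through the scaled hexagon (`shell_isTwelveConfig`, helper A), hence an FCC or HCP pattern
(`isArrangedIn_of_isTwelveConfig_of_hexagon`, helper A, via Hales's layer-shell lemma).  Hales's
*Dense Sphere Packings* §1.3 (`HalesDSP_layerPackings_holds`, in the tree) makes `V` an isometric
image `g '' barlowStacking 2 (2√(2/3)) s`; unscaling, `X = g' '' barlowStacking d (d√(2/3)) s` with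
the isometry `g' z = (d/2) g ((2/d) z)`, and `√(d² − d²/3) = d √(2/3)`.
-/

noncomputable section

namespace Summit.AtomisticToContinuum.Crystallization.Theorems.SquareWellLayerCake.StackingFaultSparsity.LocalFrames.OneLength

open Literature.Geometry.DiscreteGeometry Literature.MathematicalPhysics.StatisticalMechanics

/-- Scaling the close-packed Barlow stacking:
`(2/d) · barlowPos d √(d² − d²/3) = barlowPos 2 (2√(2/3))` for `d > 0`. [folklore] -/
theorem smul_barlowPos_oneLength {d : ℝ} (hd : 0 < d) (s : ℤ → ℤ) (k i j : ℤ) :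
    (2 / d) • barlowPos d (√(d ^ 2 - d ^ 2 / 3)) s k i j =
      barlowPos 2 (2 * Real.sqrt (2 / 3)) s k i j := by
  have hsq : √(d ^ 2 - d ^ 2 / 3) = d * Real.sqrt (2 / 3) := by
    rw [show d ^ 2 - d ^ 2 / 3 = d ^ 2 * (2 / 3) by ring, Real.sqrt_mul (sq_nonneg d),
      Real.sqrt_sq hd.le]
  have hd' : d ≠ 0 := hd.ne'
  ext l
  fin_cases l <;> simp [hsq] <;> field_simp

/-- **S12 (one-length local frames ⇒ Barlow stacking).** A nonempty point set `X ⊂ ℝ³` all of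
whose points carry exact one-length local frames (`a = b = d`) is an isometric image of
`barlowStacking d √(d² − d²/3) s` for a Hägg sequence `s`: after scaling by `2/d` every closed unit
shell is a twelve-point configuration through a hexagon, hence an FCC/HCP pattern, the scaled set
is a packing of unit balls, and Hales's layer theorem (*Dense Sphere Packings* §1.3) applies. -/
theorem stub_barlowOfOneLength :
    ∀ (X : Set (EuclideanSpace ℝ (Fin 3))) (d : ℝ), X.Nonempty → (∀ p ∈ X, ∃ (n : EuclideanSpace ℝ (Fin 3)) (c : ℤ → ℝ), (19 / 20 ≤ d ∧ d ≤ 1 ∧ 19 / 20 ≤ d ∧ d ≤ 1 ∧ ‖n‖ = 1 ∧ c 0 = 0 ∧ (∀ k : ℤ, c k + 19 / 25 ≤ c (k + 1)) ∧ (∀ q ∈ X, ∀ r ∈ X, q ≠ r → 19 / 20 ≤ dist q r) ∧ (∀ q ∈ X, dist q p < 2 → ∃ k : ℤ, inner ℝ (q - p) n = c k) ∧ (∃ H U D : Finset (EuclideanSpace ℝ (Fin 3)), H.card = 6 ∧ U.card = 3 ∧ D.card = 3 ∧ (∀ q ∈ H, q ∈ X ∧ inner ℝ (q - p) n = 0 ∧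 dist p q = d) ∧ (∀ q ∈ U, q ∈ X ∧ inner ℝ (q - p) n = c 1 ∧ dist p q = d) ∧ (∀ q ∈ D, q ∈ X ∧ inner ℝ (q - p) n = c (-1) ∧ dist p q = d) ∧ (∀ q ∈ X, q ≠ p → dist q p ≤ 1 → q ∈ H ∨ q ∈ U ∨ q ∈ D)) ∧ (∀ q ∈ X, q ≠ p → dist q p ≤ 1 → (∃ H' : Finset (EuclideanSpace ℝ (Fin 3)), H'.card = 6 ∧ ∀ r ∈ H', r ∈ X ∧ r ≠ q ∧ inner ℝ (r - p) n = inner ℝ (q - p) n ∧ dist q r = d) ∧ (∃ U' : Finset (EuclideanSpace ℝ (Fin 3)), U'.card = 3 ∧ ∀ r ∈ U', r ∈ X ∧ (∃ k : ℤ, inner ℝ (q - p) n = c k ∧ inner ℝ (r - p) n = c (k + 1)) ∧ dist q r = d) ∧ (∃ D' : Finset (EuclideanSpace ℝ (Fin 3)), D'.card = 3 ∧ ∀ r ∈ D', r ∈ X ∧ (∃ k : ℤ, inner ℝ (q - p) n = c k ∧ inner ℝ (r - p) n = c (k - 1)) ∧ dist q r = d) ∧ (∀ r ∈ X, r ≠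 q → dist q r < 1 → (inner ℝ (r - p) n = inner ℝ (q - p) n → dist q r = d) ∧ (inner ℝ (r - p) n ≠ inner ℝ (q - p) n → dist q r = d))))) → ∃ s : ℤ → ℤ, Literature.MathematicalPhysics.StatisticalMechanics.IsHaggSeq s ∧ ∃ g : EuclideanSpace ℝ (Fin 3) ≃ᵢ EuclideanSpace ℝ (Fin 3), X = g '' Literature.MathematicalPhysics.StatisticalMechanics.barlowStacking d (√(d ^ 2 - d ^ 2 / 3)) s := by
  intro X d hne hframe
  classical
  obtain ⟨p₀, hp₀⟩ := hne
  obtain ⟨-, -, hd1, hd2, -⟩ := hframe p₀ hp₀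
  have hd0 : 0 < d := by linarith
  have hdd : d / 2 * (2 / d) = 1 := by field_simp
  -- closed-shell exactness: distinct points at distance `≤ 1` are at distance `d`
  have hexact : ∀ p ∈ X, ∀ q ∈ X, q ≠ p → dist q p ≤ 1 → dist p q = d := by
    intro p hp q hq hqp hle
    obtain ⟨n, c, -, -, -, -, -, -, -, -, -, ⟨H, U, D, -, -, -, hH, hU, hD, hclosed⟩, -⟩ :=
      hframe p hp
    rcases hclosed q hq hqp hle with h | h | h
    exacts [(hH q h).2.2, (hU q h).2.2, (hD q h).2.2]
  -- the scaled set
  set V : Set (EuclideanSpace ℝ (Fin 3)) := {v | (d / 2) • v ∈ X} with hV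
  have hVne : V.Nonempty := ⟨(2 / d) • p₀, by
    show (d / 2) • (2 / d) • p₀ ∈ X
    rwa [smul_smul, hdd, one_smul]⟩
  have hpack : IsUnitBallPacking V := by
    intro v hv w hw hvw
    by_contra hne
    have hne' : (d / 2) • w ≠ (d / 2) • v := fun h =>
      hne (smul_right_injective _ (by positivity : d / 2 ≠ 0) h).symm
    have hdist : dist ((d / 2) • v) ((d / 2) • w) = d / 2 * dist v w := by
      rw [dist_smul₀, Real.norm_of_nonneg (by positivity)]
    have hle : dist ((d / 2) • w) ((d / 2) • v) ≤ 1 := by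
      rw [dist_comm, hdist]; nlinarith [dist_nonneg (x := v) (y := w)]
    have h := hexact _ hv _ hw hne' hle
    rw [hdist] at h
    have : dist v w = 2 := by field_simp at h; linarith
    linarith
  have hshells : HasFccOrHcpShells V := by
    intro u hu
    have hp : (d / 2) • u ∈ X := hu
    obtain ⟨n, c, -, -, -, -, hn, hc0, hgap, -, -, ⟨H, U, D, hH6, hU3, hD3, hH, hU, hD, hclosed⟩,
      hshell⟩ := hframe _ hp
    have hsharp : ∀ q ∈ X, q ≠ (d / 2) • u → dist q ((d / 2) • u) ≤ 1 →
        ∀ r ∈ X, r ≠ q → dist q r < 1 → dist q r = d := by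
      intro q hq hqp hle r hr hrq hlt
      have h := (hshell q hq hqp hle).2.2.2 r hr hrq hlt
      by_cases hh : inner ℝ (r - (d / 2) • u) n = inner ℝ (q - (d / 2) • u) n
      exacts [h.1 hh, h.2 hh]
    obtain ⟨hT, F, hF6, hF⟩ := shell_isTwelveConfig X d ((d / 2) • u) n c H U D hd0 hd2 hc0 hgap
      hH6 hU3 hD3 hH hU hD hclosed hsharp
    have hK : kissingShell V u =
        {y : EuclideanSpace ℝ (Fin 3) | (d / 2) • u + (d / 2) • y ∈ X ∧ ‖y‖ = 2} := by
      ext y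
      simp only [mem_kissingShell_iff, hV, Set.mem_setOf_eq, smul_add]
    rw [hK]
    exact isArrangedIn_of_isTwelveConfig_of_hexagon _ n hn hT F hF6 hF
  obtain ⟨s, hs, g, hg⟩ := HalesDSP_layerPackings_holds V hpack hVne hshells
  -- unscale: `g' z = (d/2) • g ((2/d) • z)`
  have hiso : Isometry (fun z : EuclideanSpace ℝ (Fin 3) => (d / 2) • g ((2 / d) • z)) := by
    refine Isometry.of_dist_eq fun z z' => ?_
    rw [dist_smul₀, g.dist_eq, dist_smul₀, Real.norm_of_nonneg (by positivity),
      Real.norm_of_nonneg (by positivity), ← mul_assoc, hdd, one_mul]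
  have hinv : ∀ z : EuclideanSpace ℝ (Fin 3),
      (d / 2) • g ((2 / d) • ((d / 2) • g.symm ((2 / d) • z))) = z := fun z => by
    rw [smul_smul, show 2 / d * (d / 2) = 1 by field_simp, one_smul, g.apply_symm_apply, smul_smul,
      hdd, one_smul]
  refine ⟨s, hs, IsometryEquiv.mk' (fun z => (d / 2) • g ((2 / d) • z))
    (fun z => (d / 2) • g.symm ((2 / d) • z)) hinv hiso, Set.ext fun x => ⟨fun hx => ?_, ?_⟩⟩
  · have hxV : (2 / d) • x ∈ V := by
      show (d / 2) • (2 / d) • x ∈ X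
      rwa [smul_smul, hdd, one_smul]
    rw [hg] at hxV
    obtain ⟨b, ⟨k, i, j, rfl⟩, hb⟩ := hxV
    refine ⟨barlowPos d _ s k i j, barlowPos_mem k i j, ?_⟩
    show (d / 2) • g ((2 / d) • barlowPos d (√(d ^ 2 - d ^ 2 / 3)) s k i j) = x
    rw [smul_barlowPos_oneLength hd0, hb, smul_smul, hdd, one_smul]
  · rintro ⟨b, ⟨k, i, j, rfl⟩, rfl⟩
    have hmem : g (barlowPos 2 (2 * Real.sqrt (2 / 3)) s k i j) ∈ V := by
      rw [hg]; exact ⟨_, barlowPos_mem k i j, rfl⟩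
    show (d / 2) • g ((2 / d) • barlowPos d (√(d ^ 2 - d ^ 2 / 3)) s k i j) ∈ X
    rw [smul_barlowPos_oneLength hd0]
    exact hmem

end Summit.AtomisticToContinuum.Crystallization.Theorems.SquareWellLayerCake.StackingFaultSparsity.LocalFrames.OneLength

end
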